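import Summits.Ventures.PercRepro.S2LPCoreP8D6
import Summits.Ventures.PercRepro.S2LPCoreP8D7
import Summits.Ventures.PercRepro.S2LPCoresP8D8to13
import Summits.Ventures.PercRepro.S2LPCoresP8D14to18
import Summits.Ventures.PercRepro.S2LPCoresP8D19to23
import Summits.Ventures.PercRepro.S2LPCoresP8D24to28
import Summits.Ventures.PercRepro.S2LPCoresP8D29to33
import Summits.Ventures.PercRepro.S2LPCoresP8D34to38
import Summits.Ventures.PercRepro.S2LPCoresP8D39to41
import Summits.Ventures.PercRepro.S2LPCoreP8D42
import Summits.Ventures.PercRepro.S2LPCoreP8D43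
import Summits.Ventures.PercRepro.S2LPCoreP8D44
import Summits.Ventures.PercRepro.S2LPCoreP8D45
import Summits.Ventures.PercRepro.S2LPCoreP8D46
import Summits.Ventures.PercRepro.S2LPCoreP8D47
import Summits.Ventures.PercRepro.S2LPCoreP8D48
import Summits.Ventures.PercRepro.S2LPCoreP8D49
import Summits.Ventures.PercRepro.S2LPCoreP8D50
import Summits.Ventures.PercRepro.S2LPCoreP8D51
import Summits.Ventures.PercRepro.S2LPCoreP8D52
import Summits.Ventures.PercRepro.S2LPCoreP8D53
import Summits.Ventures.PercRepro.S2LPCoreP8D54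
import Summits.Ventures.PercRepro.S2LPCoreP8D55
import Summits.Ventures.PercRepro.S2LPCoreP8D56
import Summits.Ventures.PercRepro.S2LPCoreP8D57
import Summits.Ventures.PercRepro.S2LPCoreP8D58
import Summits.Ventures.PercRepro.S2LPCoreP8D59
import Summits.Ventures.PercRepro.S2LPCoreP8D60
import Summits.Ventures.PercRepro.S2LPCoreP8D61
import Summits.Ventures.PercRepro.S2LPCoreP8D62
import Summits.Ventures.PercRepro.S2LPCoreP8D63
import Summits.Ventures.PercRepro.S2LPCoreP8D64
import Summits.Ventures.PercRepro.S2LPCoreP8D65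
import Summits.Ventures.PercRepro.S2LPCoreP8D66
import Summits.Ventures.PercRepro.S2LPCoreP8D67
import Summits.Ventures.PercRepro.S2LPCoreP8D68
import Summits.Ventures.PercRepro.S2LPCoreP8D69
import Summits.Ventures.PercRepro.S2LPCoreP8D70
import Summits.Ventures.PercRepro.S2LPCoreP8D71
import Summits.Ventures.PercRepro.S2LPCoreP8D72
import Summits.Ventures.PercRepro.S2LPCoreP8D73
import Summits.Ventures.PercRepro.HyperplaneKeyFive

/-!
# PercRepro — THE ROW `p = 8` OF LEVEL `5` ON THE `e`-FREE CORE AT EVERY CORANK `d ≥ 6` (p2 gen 31, tools/gen_row31.py in p1 g42's shape: the dispatcher over the landed wrappers and the hyperplane key)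

`c025_core_five_row_eight`: every `e`-free matroid of rank `8` on `≥ 14` points satisfies `ThmN.RLS M 8 5` — the cells
`(8, d)` for `6 ≤ d ≤ 73` (the landed wrappers `c025_core_five_eight_<d>`: the singles `S2LPCoreP8D<d>` and the packs
`S2LPCoresP8D<a>to<b>`, one `interval_cases` branch each) and the hyperplane key `HypKey.c025_core_five_hyperplane_key_eight`
for `d ≥ 74`. An S2 feeder (p7 owns the section); no window claim. Nothing else is claimed.
-/

open scoped Matroid

namespace PercRepro

namespace S2LP

variable {α : Type}

/-- **THE ROW `8` AT LEVEL `5`, EVERY CORANK `≥ 6`.** -/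
theorem c025_core_five_row_eight (M : Matroid α) [M.Finite] (hR : M.eRank = ((8 : ℕ) : ℕ∞))
    (hfree : ∀ e ∈ M.E, ∃ A ⊆ M.E \ {e}, e ∉ M.closure A ∧ e ∉ M.closure ((M.E \ {e}) \ A))
    (h6 : 8 + 6 ≤ M.E.ncard) : ThmN.RLS M 8 5 := by
  rcases Nat.lt_or_ge M.E.ncard (8 + 73 + 1) with hsmall | hbig
  · have hb : 8 + 6 ≤ M.E.ncard ∧ M.E.ncard ≤ 8 + 73 := ⟨h6, by omega⟩
    obtain ⟨hlo, hhi⟩ := hb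
    interval_cases hn : M.E.ncard
    · exact c025_core_five_eight_six M hR (by rw [hn]) hfree
    · exact c025_core_five_eight_seven M hR (by rw [hn]) hfree
    · exact c025_core_five_eight_eight M hR (by rw [hn]) hfree
    · exact c025_core_five_eight_nine M hR (by rw [hn]) hfree
    · exact c025_core_five_eight_ten M hR (by rw [hn]) hfree
    · exact c025_core_five_eight_eleven M hR (by rw [hn]) hfree
    · exact c025_core_five_eight_twelve M hR (by rw [hn]) hfree
    · exact c025_core_five_eight_thirteen M hR (by rw [hn]) hfree
    · exact c025_core_five_eight_fourteen M hR (by rw [hn]) hfree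
    · exact c025_core_five_eight_fifteen M hR (by rw [hn]) hfree
    · exact c025_core_five_eight_sixteen M hR (by rw [hn]) hfree
    · exact c025_core_five_eight_seventeen M hR (by rw [hn]) hfree
    · exact c025_core_five_eight_eighteen M hR (by rw [hn]) hfree
    · exact c025_core_five_eight_nineteen M hR (by rw [hn]) hfree
    · exact c025_core_five_eight_twenty M hR (by rw [hn]) hfree
    · exact c025_core_five_eight_twentyone M hR (by rw [hn]) hfree
    · exact c025_core_five_eight_twentytwo M hR (by rw [hn]) hfree
    · exact c025_core_five_eight_twentythree M hR (by rw [hn]) hfree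
    · exact c025_core_five_eight_twentyfour M hR (by rw [hn]) hfree
    · exact c025_core_five_eight_twentyfive M hR (by rw [hn]) hfree
    · exact c025_core_five_eight_twentysix M hR (by rw [hn]) hfree
    · exact c025_core_five_eight_twentyseven M hR (by rw [hn]) hfree
    · exact c025_core_five_eight_twentyeight M hR (by rw [hn]) hfree
    · exact c025_core_five_eight_twentynine M hR (by rw [hn]) hfree
    · exact c025_core_five_eight_thirty M hR (by rw [hn]) hfree
    · exact c025_core_five_eight_thirtyone M hR (by rw [hn]) hfree
    · exact c025_core_five_eight_thirtytwo M hR (by rw [hn]) hfree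
    · exact c025_core_five_eight_thirtythree M hR (by rw [hn]) hfree
    · exact c025_core_five_eight_thirtyfour M hR (by rw [hn]) hfree
    · exact c025_core_five_eight_thirtyfive M hR (by rw [hn]) hfree
    · exact c025_core_five_eight_thirtysix M hR (by rw [hn]) hfree
    · exact c025_core_five_eight_thirtyseven M hR (by rw [hn]) hfree
    · exact c025_core_five_eight_thirtyeight M hR (by rw [hn]) hfree
    · exact c025_core_five_eight_thirtynine M hR (by rw [hn]) hfree
    · exact c025_core_five_eight_forty M hR (by rw [hn]) hfree
    · exact c025_core_five_eight_fortyone M hR (by rw [hn]) hfree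
    · exact c025_core_five_eight_fortytwo M hR (by rw [hn]) hfree
    · exact c025_core_five_eight_fortythree M hR (by rw [hn]) hfree
    · exact c025_core_five_eight_fortyfour M hR (by rw [hn]) hfree
    · exact c025_core_five_eight_fortyfive M hR (by rw [hn]) hfree
    · exact c025_core_five_eight_fortysix M hR (by rw [hn]) hfree
    · exact c025_core_five_eight_fortyseven M hR (by rw [hn]) hfree
    · exact c025_core_five_eight_fortyeight M hR (by rw [hn]) hfree
    · exact c025_core_five_eight_fortynine M hR (by rw [hn]) hfree
    · exact c025_core_five_eight_fifty M hR (by rw [hn]) hfree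
    · exact c025_core_five_eight_fiftyone M hR (by rw [hn]) hfree
    · exact c025_core_five_eight_fiftytwo M hR (by rw [hn]) hfree
    · exact c025_core_five_eight_fiftythree M hR (by rw [hn]) hfree
    · exact c025_core_five_eight_fiftyfour M hR (by rw [hn]) hfree
    · exact c025_core_five_eight_fiftyfive M hR (by rw [hn]) hfree
    · exact c025_core_five_eight_fiftysix M hR (by rw [hn]) hfree
    · exact c025_core_five_eight_fiftyseven M hR (by rw [hn]) hfree
    · exact c025_core_five_eight_fiftyeight M hR (by rw [hn]) hfree
    · exact c025_core_five_eight_fiftynine M hR (by rw [hn]) hfree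
    · exact c025_core_five_eight_sixty M hR (by rw [hn]) hfree
    · exact c025_core_five_eight_sixtyone M hR (by rw [hn]) hfree
    · exact c025_core_five_eight_sixtytwo M hR (by rw [hn]) hfree
    · exact c025_core_five_eight_sixtythree M hR (by rw [hn]) hfree
    · exact c025_core_five_eight_sixtyfour M hR (by rw [hn]) hfree
    · exact c025_core_five_eight_sixtyfive M hR (by rw [hn]) hfree
    · exact c025_core_five_eight_sixtysix M hR (by rw [hn]) hfree
    · exact c025_core_five_eight_sixtyseven M hR (by rw [hn]) hfree
    · exact c025_core_five_eight_sixtyeight M hR (by rw [hn]) hfree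
    · exact c025_core_five_eight_sixtynine M hR (by rw [hn]) hfree
    · exact c025_core_five_eight_seventy M hR (by rw [hn]) hfree
    · exact c025_core_five_eight_seventyone M hR (by rw [hn]) hfree
    · exact c025_core_five_eight_seventytwo M hR (by rw [hn]) hfree
    · exact c025_core_five_eight_seventythree M hR (by rw [hn]) hfree
  · exact HypKey.c025_core_five_hyperplane_key_eight M hR (by omega) hfree

end S2LP

end PercRepro
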